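import Literature.NumberTheory.Automorphic.GL2CESHFamilyDeriv
import Literature.NumberTheory.Automorphic.UnitaryTwoExpProduct
import Literature.NumberTheory.Automorphic.GL2CVanEst
import HarnessLib

/-!
# The Eichler–Shimura–Harder family is an automorphic family of closed equivariant cochains

For the data `D : GL2CESH.FamilyData K hcpt` of `GL2CESHFamilyDeriv` (a clean cuspidal `π` on
`GL₂` over an imaginary quadratic field `K`, `Θ`, a closed level-`K(𝔫)` Kuga `1`-cochain `η` of the
model, opposite central scalars) we prove that `c ↦ D.family c` is a
`GL2C.IsAutomorphicFamily (diagPos 2 K) (level 2 K 𝔫) (coeffRepPos ℂ 2 K λ) (σ₀ ∘ incl)`: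

* `fderiv` of `M ↦ family c X M` in the direction `M Z` is read off the one-parameter derivative
  (`hasDerivAt_family_mul_expGL`): along `x_i ∈ 𝔭₀` it is Kuga's `D_i`, along `𝔲(2)` it is
  `family c [Z, X]` (cochain condition of `η` + opposite central scalars) — **closedness** and
  **infinitesimal `U(2)`-equivariance**;
* integrating along `exp(sZ)` (`is_const_of_deriv_eq_zero`) and writing `k ∈ U(2)` as a product of
  four exponentials (`UnitaryTwo.exists_exp_prod_of_mem_unitaryGroup`) gives
  `family c (k X k*) M = family c X (M k)`; along `exp(t·1)` it gives `A_G`-invariance;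
* right `K(𝔫)`-invariance (the entries of `η` are `K(𝔫)`-fixed) and left `GL₂(K)`-equivariance
  (automorphy of the entries, `coeffRepC (σ₀ γ) = coeffRep γ`).
[cite: Harder1987, §3.1] [cite: BorelWallach2000, I §1.2, I §5.1 and VII §2.2]

Theorems only; no named fact.
-/

noncomputable section

-- Mathlib idiom (Mathlib/Algebra/Lie/OfAssociative.lean), as in `GL2CCuspFormOps`.
attribute [local instance 100] LieRing.ofAssociativeRing

open scoped Matrix ComplexConjugate MatrixGroups Topology Matrix.Norms.Operator ContDiff BigOperators
open Complex Filter Finset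

namespace Literature.NumberTheory.Automorphic

namespace GL2CESH

namespace FamilyData

open scoped Classical
open _root_.NumberField _root_.NumberField.InfinitePlace _root_.NumberField.mixedEmbedding IsDedekindDomain
open RealMatrixGroup ComplexPlace ImaginaryQuadratic GL2CCoeff GL2CAut GL2CKType GL2CCuspForm GL2C
open AutomorphicRepData GLnComplexCasimir GL2ComplexCasimir GL2CESHMat Matrix

variable {K : Type} [Field K] [NumberField K] [IsTotallyComplex K] {hcpt : isCompact_glFiniteIntegralLevel 2 K}
  (D : FamilyData K hcpt)

/-! ### The family along curves `M exp(sZ)` -/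

/-- `toGL (M g) = toGL M · g` for `M` invertible. [folklore] -/
theorem toGL_mul_coe {M : Mat} (hM : M ∈ GL2C.Inv) (g : GL (Fin 2) ℂ) : toGL (M * (g : Mat)) = toGL M * g := by
  rw [show M * (g : Mat) = ((toGL M * g : GL (Fin 2) ℂ) : Mat) by rw [Units.val_mul, coe_toGL hM], toGL_coe]

/-- The family along `M exp(sZ)`, through `toGL M · expGL(sZ)`. [folklore] -/
theorem family_mul_exp {M : Mat} (hM : M ∈ GL2C.Inv) (c : BigHeckeGLn.FiniteAdelicGL 2 K) (X Z : Mat) (s : ℝ) :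
    D.family c X (M * NormedSpace.exp (s • Z)) =
      coeffRepC K D.lam (toGL M * expGL (s • Z)) (D.vec X (pt K (toGL M * expGL (s • Z)) c)) := by
  rw [family_apply, ← coe_expGL, toGL_mul_coe hM]

/-- The components of the family are differentiable at invertible matrices. [folklore] -/
theorem differentiableAt_family (h2 : Module.finrank ℚ K = 2) (c : BigHeckeGLn.FiniteAdelicGL 2 K) (X : Mat)
    {M : Mat} (hM : M ∈ GL2C.Inv) : DifferentiableAt ℝ (D.family c X) M :=
  ((D.contDiffOn_family h2 c X (n := 1)).differentiableOn (by simp)).differentiableAt (isOpen_Inv.mem_nhds hM)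

/-- `d/ds|₀ family c X (M exp(sZ)) = fderiv (family c X) M (M Z)`. [folklore] -/
theorem hasDerivAt_family_curve (h2 : Module.finrank ℚ K = 2) (c : BigHeckeGLn.FiniteAdelicGL 2 K) (X Z : Mat)
    {M : Mat} (hM : M ∈ GL2C.Inv) :
    HasDerivAt (fun s : ℝ => D.family c X (M * NormedSpace.exp (s • Z))) (fderiv ℝ (D.family c X) M (M * Z)) 0 := by
  have hc : HasDerivAt (fun s : ℝ => M * NormedSpace.exp (s • Z)) (M * Z) 0 := (hasDerivAt_exp_smul_zero Z).const_mul M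
  exact (D.differentiableAt_family h2 c X hM).hasFDerivAt.comp_hasDerivAt_of_eq 0 hc (by simp)

/-- **`fderiv` along `x_i ∈ 𝔭₀` is Kuga's `D_i`.** [cite: BorelWallach2000, I §1.2] -/
theorem fderiv_family_Xmat (h2 : Module.finrank ℚ K = 2) (c : BigHeckeGLn.FiniteAdelicGL 2 K) (X : Mat) (i : Fin 3)
    {M : Mat} (hM : M ∈ GL2C.Inv) :
    fderiv ℝ (D.family c X) M (M * Xmat i) =
      coeffRepC K D.lam (toGL M) (D.Θ (mapModel D.d (D.evalW (pt K (toGL M) c)) (D.setup.D i (D.ηX X)))) :=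
  (D.hasDerivAt_family_curve h2 c X (Xmat i) hM).unique
    ((D.hasDerivAt_family_Xmat h2 c X i (toGL M)).congr_of_eventuallyEq
      (Eventually.of_forall fun s => D.family_mul_exp hM c X (Xmat i) s))

/-- **`fderiv` along `y_α ∈ 𝔰𝔲(2)` is `(π + ρ)(y_α)`.** [cite: BorelWallach2000, I §1.2] -/
theorem fderiv_family_Ymat (h2 : Module.finrank ℚ K = 2) (c : BigHeckeGLn.FiniteAdelicGL 2 K) (X : Mat) (α : Fin 3)
    {M : Mat} (hM : M ∈ GL2C.Inv) :
    fderiv ℝ (D.family c X) M (M * Ymat α) =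
      coeffRepC K D.lam (toGL M) (D.Θ (mapModel D.d (D.evalW (pt K (toGL M) c))
        (D.setup.πk α (D.ηX X) + D.setup.ρk α (D.ηX X)))) :=
  (D.hasDerivAt_family_curve h2 c X (Ymat α) hM).unique
    ((D.hasDerivAt_family_Ymat h2 c X α (toGL M)).congr_of_eventuallyEq
      (Eventually.of_forall fun s => D.family_mul_exp hM c X (Ymat α) s))

/-- `fderiv` along the centre `1` vanishes. [cite: Harder1987, §3.1] -/
theorem fderiv_family_one (h2 : Module.finrank ℚ K = 2) (c : BigHeckeGLn.FiniteAdelicGL 2 K) (X : Mat)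
    {M : Mat} (hM : M ∈ GL2C.Inv) : fderiv ℝ (D.family c X) M (M * 1) = 0 :=
  (D.hasDerivAt_family_curve h2 c X 1 hM).unique
    ((D.hasDerivAt_family_one h2 c X (toGL M)).congr_of_eventuallyEq
      (Eventually.of_forall fun s => D.family_mul_exp hM c X 1 s))

/-- `fderiv` along `i·1` vanishes. [cite: Harder1987, §3.1] -/
theorem fderiv_family_I_one (h2 : Module.finrank ℚ K = 2) (c : BigHeckeGLn.FiniteAdelicGL 2 K) (X : Mat)
    {M : Mat} (hM : M ∈ GL2C.Inv) : fderiv ℝ (D.family c X) M (M * (I • 1)) = 0 :=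
  (D.hasDerivAt_family_curve h2 c X (I • 1) hM).unique
    ((D.hasDerivAt_family_I_one h2 c X (toGL M)).congr_of_eventuallyEq
      (Eventually.of_forall fun s => D.family_mul_exp hM c X (I • 1) s))

/-! ### Reading the family on `𝔭₀` -/

/-- `η(x_j) = η j`. [folklore] -/
theorem ηX_Xmat (j : Fin 3) : D.ηX (Xmat j) = D.η j := by
  have hx : xcoord (Xmat j) = fun i => if i = j then 1 else 0 := by
    have := xcoord_sum_smul_Xmat (fun i => if i = j then (1 : ℝ) else 0)
    rw [Finset.sum_eq_single j (fun i _ hi => by simp [hi]) (by simp)] at this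
    simpa using this
  rw [ηX, hx]
  simp only [apply_ite Complex.ofReal, Complex.ofReal_one, Complex.ofReal_zero, ite_smul, one_smul, zero_smul,
    Finset.sum_ite_eq', Finset.mem_univ, if_true]

/-- The family at `x_j`: `E(M) Θ(η j (M, c))`. [folklore] -/
theorem family_Xmat (c : BigHeckeGLn.FiniteAdelicGL 2 K) (j : Fin 3) (M : Mat) :
    D.family c (Xmat j) M = coeffRepC K D.lam (toGL M) (D.Θ (mapModel D.d (D.evalW (pt K (toGL M) c)) (D.η j))) := by
  rw [family_apply, vec, ηX_Xmat]

/-- On `𝔭₀` the family is the `xcoord`-combination of its values at the `x_j`. [folklore] -/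
theorem family_eq_sum_xcoord {W : Mat} (hW : IsHT W) (c : BigHeckeGLn.FiniteAdelicGL 2 K) (M : Mat) :
    D.family c W M = ∑ j, (xcoord W j : ℝ) • D.family c (Xmat j) M := by
  conv_lhs => rw [← sum_xcoord_smul_Xmat hW]
  simp only [Complex.coe_smul, map_sum, LinearMap.map_smul_of_tower, Finset.sum_apply, Pi.smul_apply]

/-- The real form of the family at any `X`: `family c X M = ∑ xcoord X j • family c x_j M`. [folklore] -/
theorem family_eq_sum_xcoord' (c : BigHeckeGLn.FiniteAdelicGL 2 K) (X M : Mat) :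
    D.family c X M = ∑ j, (xcoord X j : ℝ) • D.family c (Xmat j) M := by
  have : D.family c X M = coeffRepC K D.lam (toGL M) (D.Θ (mapModel D.d (D.evalW (pt K (toGL M) c)) (D.ηX X))) := rfl
  rw [this, ηX]
  simp only [map_sum, map_smul, family_Xmat, ← Complex.coe_smul]

/-! ### Infinitesimal `U(2)`-equivariance -/

/-- The `𝔰𝔲(2)`-directions: `E(M) Θ(((π+ρ)(y_α) η(X))(M,c)) = family c [y_α, X] M` for `X ∈ 𝔭₀`
(the cochain condition of `η`). [cite: BorelWallach2000, I §1.2 and I §5.1] -/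
theorem fderiv_family_Ymat_eq (h2 : Module.finrank ℚ K = 2) (c : BigHeckeGLn.FiniteAdelicGL 2 K) {X : Mat}
    (hX : IsHT X) (α : Fin 3) {M : Mat} (hM : M ∈ GL2C.Inv) :
    fderiv ℝ (D.family c X) M (M * Ymat α) = D.family c (Ymat α * X - X * Ymat α) M := by
  have hlie : Ymat α * X - X * Ymat α = ∑ j, (((∑ i, xcoord X i * aRe α i j : ℝ) : ℝ) : ℂ) • Xmat j := by
    rw [← Ring.lie_def]; exact lie_Ymat_of_isHT α hX
  -- the right-hand side
  rw [hlie, map_sum, Finset.sum_apply]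
  simp_rw [Complex.coe_smul, LinearMap.map_smul_of_tower, Pi.smul_apply]
  -- the left-hand side: cochain condition
  have hL : D.setup.πk α (D.ηX X) + D.setup.ρk α (D.ηX X) = ∑ j, (∑ i, ((xcoord X i : ℝ) : ℂ) * aTab α i j) • D.η j := by
    have h1 : D.setup.πk α (D.ηX X) + D.setup.ρk α (D.ηX X) = ∑ i, ((xcoord X i : ℝ) : ℂ) • ∑ j, aTab α i j • D.η j := by
      rw [ηX, map_sum, map_sum, ← Finset.sum_add_distrib]
      refine Finset.sum_congr rfl fun i _ => ?_
      rw [map_smul, map_smul, ← smul_add]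
      congr 1
      exact D.hcoch α i
    rw [h1]
    simp only [Finset.smul_sum, smul_smul]
    rw [Finset.sum_comm]
    simp only [Finset.sum_smul]
  rw [D.fderiv_family_Ymat h2 c X α hM, hL, map_sum, map_sum, map_sum]
  refine Finset.sum_congr rfl fun j _ => ?_
  rw [LinearMap.map_smul, LinearEquiv.map_smul, LinearMap.map_smul, ← family_Xmat, ← Complex.coe_smul]
  congr 1
  push_cast
  simp only [aRe_eq]

/-- **Infinitesimal `U(2)`-equivariance**: `fderiv (family c X) M (M Z) = family c [Z, X] M` for
`Z ∈ 𝔲(2)`, `X ∈ 𝔭₀`. [cite: BorelWallach2000, I §1.2 and I §5.1] -/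
theorem fderiv_family_skew (h2 : Module.finrank ℚ K = 2) (c : BigHeckeGLn.FiniteAdelicGL 2 K) {X Z : Mat}
    (hX : IsHT X) (hZ : Zᴴ = -Z) {M : Mat} (hM : M ∈ GL2C.Inv) :
    fderiv ℝ (D.family c X) M (M * Z) = D.family c (Z * X - X * Z) M := by
  -- both sides are real-linear in `Z`
  set Lf : Mat →ₗ[ℝ] ResGLnCohomology.CoeffModule ℂ 2 K D.lam :=
    (fderiv ℝ (D.family c X) M).toLinearMap.comp (LinearMap.mulLeft ℝ M) with hLf
  set Rf : Mat →ₗ[ℝ] ResGLnCohomology.CoeffModule ℂ 2 K D.lam :=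
    (LinearMap.proj M).comp ((D.family c).comp (LinearMap.mulRight ℝ X - LinearMap.mulLeft ℝ X)) with hRf
  have hL : ∀ W, Lf W = fderiv ℝ (D.family c X) M (M * W) := fun W => rfl
  have hR : ∀ W, Rf W = D.family c (W * X - X * W) M := fun W => by
    simp only [hRf, LinearMap.comp_apply, LinearMap.sub_apply, LinearMap.mulRight_apply, LinearMap.mulLeft_apply,
      LinearMap.proj_apply]
  rw [← hL, ← hR]
  -- decompose `Z`
  have h1 : Lf (I • 1) = Rf (I • 1) := by
    rw [hL, hR, D.fderiv_family_I_one h2 c X hM, Matrix.smul_mul, Matrix.mul_smul, Matrix.one_mul, Matrix.mul_one,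
      sub_self, map_zero, Pi.zero_apply]
  have hY : ∀ α, Lf (Ymat α) = Rf (Ymat α) := fun α => by
    rw [hL, hR, D.fderiv_family_Ymat_eq h2 c hX α hM]
  conv_lhs => rw [← zcoord_decomp hZ]
  conv_rhs => rw [← zcoord_decomp hZ]
  simp only [Complex.coe_smul, map_add, map_sum, LinearMap.map_smul, h1, hY]

/-! ### Integrating to `U(2)` -/

/-- `exp W` is invertible. [folklore] -/
theorem exp_mem_Inv (W : Mat) : NormedSpace.exp W ∈ GL2C.Inv :=
  mem_Inv.2 ((Matrix.isUnit_iff_isUnit_det _).1 (Matrix.isUnit_exp W))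

/-- `exp Z · exp(−Z) = 1`. [folklore] -/
theorem exp_mul_exp_neg (Z : Mat) : NormedSpace.exp Z * NormedSpace.exp (-Z) = 1 := by
  rw [← Matrix.exp_add_of_commute _ _ (Commute.neg_right (Commute.refl Z)), add_neg_cancel]
  exact NormedSpace.exp_zero

/-- **`U(2)`-equivariance along a one-parameter subgroup**:
`family c (e^{Z} X e^{−Z}) M = family c X (M e^{Z})` for `Z ∈ 𝔲(2)`, `X ∈ 𝔭₀` — the function
`s ↦ family c (e^{sZ} X e^{−sZ}) (M e^{Z} e^{−sZ})` has derivative `0` (infinitesimal equivariance).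
[cite: BorelWallach2000, I §1.2 and I §5.1] -/
theorem family_conj_exp (h2 : Module.finrank ℚ K = 2) (c : BigHeckeGLn.FiniteAdelicGL 2 K) {X Z : Mat}
    (hX : IsHT X) (hZ : Zᴴ = -Z) {M : Mat} (hM : M ∈ GL2C.Inv) :
    D.family c (NormedSpace.exp Z * X * star (NormedSpace.exp Z)) M = D.family c X (M * NormedSpace.exp Z) := by
  set g : Mat := M * NormedSpace.exp Z with hg
  set k : ℝ → Mat := fun s => NormedSpace.exp (s • Z) with hk
  set A : ℝ → Mat := fun s => k s * X * star (k s) with hA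
  set m : ℝ → Mat := fun s => g * NormedSpace.exp (s • (-Z)) with hm
  have hZ' : (-Z)ᴴ = -(-Z) := by rw [Matrix.conjTranspose_neg, hZ]
  have hAht : ∀ s, IsHT (A s) := fun s => hX.conj (exp_smul_mem_unitaryGroup hZ s)
  have hg_inv : g ∈ GL2C.Inv := mul_mem_Inv hM (exp_mem_Inv Z)
  have hm_inv : ∀ s, m s ∈ GL2C.Inv := fun s => mul_mem_Inv hg_inv (exp_mem_Inv _)
  -- derivatives of the curves
  have hkd : ∀ s, HasDerivAt k (Z * k s) s := fun s => by
    have h : HasDerivAt (fun s : ℝ => NormedSpace.exp (s • Z)) (Z * NormedSpace.exp (s • Z)) s :=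
      hasDerivAt_exp_smul_const' (𝕂 := ℝ) Z s
    exact h
  have hAd : ∀ s, HasDerivAt A (Z * A s - A s * Z) s := fun s => by
    have h := ((hkd s).mul_const X).mul (hkd s).star
    refine h.congr_deriv ?_
    simp only [hA, star_mul, Matrix.star_eq_conjTranspose Z, hZ, Matrix.mul_neg, Matrix.mul_assoc]
    abel
  have hmd : ∀ s, HasDerivAt m (m s * -Z) s := fun s => by
    have h := (hasDerivAt_exp_smul_const (𝕂 := ℝ) (-Z) s).const_mul g
    rw [← Matrix.mul_assoc] at h
    exact h
  -- the scalar coefficients and the vector factors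
  have had : ∀ s j, HasDerivAt (fun u => xcoord (A u) j) (xcoord (Z * A s - A s * Z) j) s := fun s j =>
    (LinearMap.toContinuousLinearMap ((LinearMap.proj j).comp xcoordLM)).hasFDerivAt.comp_hasDerivAt s (hAd s)
  have hbd : ∀ s j, HasDerivAt (fun u => D.family c (Xmat j) (m u)) (D.family c (-Z * Xmat j - Xmat j * -Z) (m s)) s :=
    fun s j =>
    ((D.differentiableAt_family h2 c (Xmat j) (hm_inv s)).hasFDerivAt.comp_hasDerivAt s (hmd s)).congr_deriv
      (D.fderiv_family_skew h2 c (isHT_Xmat j) hZ' (hm_inv s))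
  -- the composite has derivative zero
  have hφ : (fun s => D.family c (A s) (m s)) = fun s => ∑ j, xcoord (A s) j • D.family c (Xmat j) (m s) :=
    funext fun s => D.family_eq_sum_xcoord (hAht s) c (m s)
  have hφd : ∀ s, HasDerivAt (fun s => D.family c (A s) (m s)) 0 s := fun s => by
    rw [hφ]
    have h := HasDerivAt.fun_sum (u := Finset.univ) fun j _ => (had s j).smul (hbd s j)
    refine h.congr_deriv ?_
    rw [Finset.sum_add_distrib, ← D.family_eq_sum_xcoord ((hAht s).bracket hZ) c (m s)]
    have e : ∀ j, -Z * Xmat j - Xmat j * -Z = -(Z * Xmat j - Xmat j * Z) := fun j => by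
      simp only [Matrix.neg_mul, Matrix.mul_neg]; abel
    have hB : Z * A s - A s * Z = ∑ j, (xcoord (A s) j : ℝ) • (Z * Xmat j - Xmat j * Z) := by
      conv_lhs => rw [← sum_xcoord_smul_Xmat (hAht s)]
      simp only [Matrix.mul_sum, Matrix.sum_mul, Matrix.mul_smul, Matrix.smul_mul, ← Finset.sum_sub_distrib,
        ← smul_sub, Complex.coe_smul]
    have h1 : ∑ j, xcoord (A s) j • D.family c (-Z * Xmat j - Xmat j * -Z) (m s) = -D.family c (Z * A s - A s * Z) (m s) := by
      simp_rw [e, map_neg, Pi.neg_apply, smul_neg, Finset.sum_neg_distrib]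
      rw [hB, map_sum, Finset.sum_apply]
      simp_rw [LinearMap.map_smul_of_tower, Pi.smul_apply]
    rw [h1, neg_add_cancel]
  -- constancy between `s = 0` and `s = 1`
  have hconst := is_const_of_deriv_eq_zero (fun s => (hφd s).differentiableAt) (fun s => (hφd s).deriv) 1 0
  have hA1 : A 1 = NormedSpace.exp Z * X * star (NormedSpace.exp Z) := by simp [hA, hk]
  have hm1 : m 1 = M := by
    simp only [hm, hg, one_smul, Matrix.mul_assoc, exp_mul_exp_neg, Matrix.mul_one]
  have hA0 : A 0 = X := by simp [hA, hk]
  have hm0 : m 0 = g := by simp [hm]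
  have h := hconst
  simp only [hA1, hm1, hA0, hm0] at h
  exact h

/-- The equivariance property for a fixed `k`. [folklore] -/
def EquivAt (c : BigHeckeGLn.FiniteAdelicGL 2 K) (k : Mat) : Prop :=
  ∀ ⦃X : Mat⦄, IsHT X → ∀ ⦃M : Mat⦄, M ∈ GL2C.Inv → D.family c (k * X * star k) M = D.family c X (M * k)

/-- `EquivAt` is multiplicative in `k` (for `k₂` unitary). [folklore] -/
theorem EquivAt.mul {c : BigHeckeGLn.FiniteAdelicGL 2 K} {k₁ k₂ : Mat} (h₁ : D.EquivAt c k₁) (h₂ : D.EquivAt c k₂)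
    (hk₁ : k₁ ∈ GL2C.Inv) (hk₂ : k₂ ∈ Matrix.unitaryGroup (Fin 2) ℂ) : D.EquivAt c (k₁ * k₂) := by
  intro X hX M hM
  have e : k₁ * k₂ * X * star (k₁ * k₂) = k₁ * (k₂ * X * star k₂) * star k₁ := by
    rw [star_mul]; simp only [Matrix.mul_assoc]
  rw [e, h₁ (hX.conj hk₂) hM, h₂ hX (mul_mem_Inv hM hk₁), Matrix.mul_assoc]

/-- `EquivAt` holds for `exp Z`, `Z ∈ 𝔲(2)`. [folklore] -/
theorem equivAt_exp (h2 : Module.finrank ℚ K = 2) (c : BigHeckeGLn.FiniteAdelicGL 2 K) {Z : Mat} (hZ : Zᴴ = -Z) :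
    D.EquivAt c (NormedSpace.exp Z) := fun _ hX _ hM => D.family_conj_exp h2 c hX hZ hM

/-- **`U(2)`-equivariance**: `family c (k X k*) M = family c X (M k)` for `k ∈ U(2)` (Euler angles:
`k` is a product of four exponentials of skew-Hermitian matrices). [cite: BorelWallach2000, I §5.1] -/
theorem equivariant_family (h2 : Module.finrank ℚ K = 2) (c : BigHeckeGLn.FiniteAdelicGL 2 K) {k : Mat}
    (hk : k ∈ Matrix.unitaryGroup (Fin 2) ℂ) {X : Mat} (hX : IsHT X) {M : Mat} (hM : M ∈ GL2C.Inv) :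
    D.family c (k * X * star k) M = D.family c X (M * k) := by
  obtain ⟨Z, hZ, hkZ⟩ := UnitaryTwo.exists_exp_prod_of_mem_unitaryGroup hk
  have hu : ∀ i, NormedSpace.exp (Z i) ∈ Matrix.unitaryGroup (Fin 2) ℂ := fun i => by
    have := exp_smul_mem_unitaryGroup (hZ i) 1
    rwa [one_smul] at this
  have hE : D.EquivAt c k := by
    rw [hkZ]
    refine (((D.equivAt_exp h2 c (hZ 0)).mul D (D.equivAt_exp h2 c (hZ 1)) (exp_mem_Inv _) (hu 1)).mul D
      (D.equivAt_exp h2 c (hZ 2)) (mul_mem_Inv (exp_mem_Inv _) (exp_mem_Inv _)) (hu 2)).mul D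
      (D.equivAt_exp h2 c (hZ 3)) (mul_mem_Inv (mul_mem_Inv (exp_mem_Inv _) (exp_mem_Inv _)) (exp_mem_Inv _)) (hu 3)
  exact hE hX hM

/-- **`A_G`-invariance**: `family c X (r M) = family c X M` for `r > 0` (along `exp(t·1)` the
derivative vanishes). [cite: Harder1987, §3.1] -/
theorem central_family (h2 : Module.finrank ℚ K = 2) (c : BigHeckeGLn.FiniteAdelicGL 2 K) {r : ℝ} (hr : 0 < r)
    (X : Mat) {M : Mat} (hM : M ∈ GL2C.Inv) : D.family c X ((r : ℂ) • M) = D.family c X M := by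
  set m : ℝ → Mat := fun t => M * NormedSpace.exp (t • (1 : Mat)) with hm
  have hm_inv : ∀ t, m t ∈ GL2C.Inv := fun t => mul_mem_Inv hM (exp_mem_Inv _)
  have hmd : ∀ t, HasDerivAt m (m t * 1) t := fun t => by
    have h := (hasDerivAt_exp_smul_const (𝕂 := ℝ) (1 : Mat) t).const_mul M
    rw [← Matrix.mul_assoc] at h
    exact h
  have hφd : ∀ t, HasDerivAt (fun t => D.family c X (m t)) 0 t := fun t =>
    ((D.differentiableAt_family h2 c X (hm_inv t)).hasFDerivAt.comp_hasDerivAt t (hmd t)).congr_deriv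
      (D.fderiv_family_one h2 c X (hm_inv t))
  have hconst := is_const_of_deriv_eq_zero (fun t => (hφd t).differentiableAt) (fun t => (hφd t).deriv) (Real.log r) 0
  have h1 : m (Real.log r) = (r : ℂ) • M := by
    rw [hm]
    change M * NormedSpace.exp (Real.log r • (1 : Mat)) = _
    rw [show Real.log r • (1 : Mat) = ((Real.log r : ℝ) : ℂ) • (1 : Mat) from (Complex.coe_smul _ _).symm,
      UnitaryTwo.exp_smul_one, ← Complex.ofReal_exp, Real.exp_log hr, Matrix.mul_smul, Matrix.mul_one]
  have h0 : m 0 = M := by simp [hm]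
  rw [h1, h0] at hconst
  exact hconst

/-! ### Closedness -/

/-- Closedness of `η`, in terms of `D.setup`. [folklore] -/
theorem hclosed' (i j : Fin 3) : D.setup.D i (D.η j) = D.setup.D j (D.η i) := D.hclosed i j

/-- `D_i η(Y) = ∑ y_j D_i η_j`. [folklore] -/
theorem setupD_ηX (i : Fin 3) (Y : Mat) : D.setup.D i (D.ηX Y) = ∑ j, ((xcoord Y j : ℝ) : ℂ) • D.setup.D i (D.η j) := by
  rw [ηX, map_sum]
  simp only [map_smul]

/-- `fderiv` along `x_i`, expanded in `η_j`. [folklore] -/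
theorem fderiv_family_Xmat_sum (h2 : Module.finrank ℚ K = 2) (c : BigHeckeGLn.FiniteAdelicGL 2 K) (Y : Mat) (i : Fin 3)
    {M : Mat} (hM : M ∈ GL2C.Inv) :
    fderiv ℝ (D.family c Y) M (M * Xmat i) = ∑ j, ((xcoord Y j : ℝ) : ℂ) •
      coeffRepC K D.lam (toGL M) (D.Θ (mapModel D.d (D.evalW (pt K (toGL M) c)) (D.setup.D i (D.η j)))) := by
  rw [D.fderiv_family_Xmat h2 c Y i hM, setupD_ηX, map_sum, map_sum, map_sum]
  simp only [map_smul]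

/-- `fderiv (family c Y) M (M X) = ∑_{i,j} x_i y_j E(M) Θ((D_i η_j)(M, c))` for `X ∈ 𝔭₀`. [folklore] -/
theorem fderiv_family_isHT (h2 : Module.finrank ℚ K = 2) (c : BigHeckeGLn.FiniteAdelicGL 2 K) {X : Mat} (hX : IsHT X)
    (Y : Mat) {M : Mat} (hM : M ∈ GL2C.Inv) :
    fderiv ℝ (D.family c Y) M (M * X) =
        ∑ i, ∑ j, ((xcoord X i * xcoord Y j : ℝ) : ℂ) •
          coeffRepC K D.lam (toGL M) (D.Θ (mapModel D.d (D.evalW (pt K (toGL M) c)) (D.setup.D i (D.η j)))) := by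
  conv_lhs => rw [← sum_xcoord_smul_Xmat hX]
  rw [Matrix.mul_sum, map_sum]
  refine Finset.sum_congr rfl fun i _ => ?_
  rw [Matrix.mul_smul, Complex.coe_smul, (fderiv ℝ (D.family c Y) M).map_smul, D.fderiv_family_Xmat_sum h2 c Y i hM,
    Finset.smul_sum]
  refine Finset.sum_congr rfl fun j _ => ?_
  rw [← Complex.coe_smul, smul_smul]
  push_cast
  rfl

/-- **Closedness**: `fderiv (family c Y) M (M X) = fderiv (family c X) M (M Y)` on `𝔭₀` (`η` is closed).
[cite: BorelWallach2000, I §1.2] -/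
theorem closed_family (h2 : Module.finrank ℚ K = 2) (c : BigHeckeGLn.FiniteAdelicGL 2 K) {X Y : Mat} (hX : IsHT X)
    (hY : IsHT Y) {M : Mat} (hM : M ∈ GL2C.Inv) :
    fderiv ℝ (D.family c Y) M (M * X) = fderiv ℝ (D.family c X) M (M * Y) := by
  rw [D.fderiv_family_isHT h2 c hX Y hM, D.fderiv_family_isHT h2 c hY X hM, Finset.sum_comm]
  refine Finset.sum_congr rfl fun i _ => Finset.sum_congr rfl fun j _ => ?_
  rw [mul_comm, D.hclosed' j i]

/-- **The family is a closed `U(2)`-equivariant `A_G`-invariant `𝔭`-cochain.**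
[cite: BorelWallach2000, I §1.2, I §5.1 and VII §2.2] -/
theorem isCochain_family (h2 : Module.finrank ℚ K = 2) (c : BigHeckeGLn.FiniteAdelicGL 2 K) :
    GL2C.IsCochain (D.family c) where
  contDiffOn X _ := D.contDiffOn_family h2 c X
  closed _ _ hX hY _ hM := D.closed_family h2 c hX hY hM
  equivariant _ hk _ hX _ hM := D.equivariant_family h2 c hk hX hM
  central _ hr X _ _ hM := D.central_family h2 c hr X hM

/-! ### Right `K(𝔫)`-invariance and left `GL₂(K)`-equivariance -/

/-- The entries of `η(X)` are `K(𝔫)`-fixed. [folklore] -/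
theorem ηX_mem_levelFixed (X : Mat) (l m : ℕ) :
    ((D.ηX X : ℕ → ℕ → D.π.W) l m) ∈ GL2CCuspForm.levelFixed D.π D.𝔫 := by
  rw [ηX, AddSubmonoidClass.coe_finsetSum, Finset.sum_apply, Finset.sum_apply]
  refine Submodule.sum_mem _ fun i _ => ?_
  rw [Submodule.coe_smul, Pi.smul_apply, Pi.smul_apply]
  exact Submodule.smul_mem _ _ (D.hfix i l m)

/-- `η(X)` read at `pt g (c u)` and at `pt g c` agree for `u ∈ K_f(𝔫)`. [cite: BorelJacquet1979, §4.2] -/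
theorem vec_mul_level (X : Mat) (g : GL (Fin 2) ℂ) (c : BigHeckeGLn.FiniteAdelicGL 2 K)
    {u : BigHeckeGLn.FiniteAdelicGL 2 K} (hu : u ∈ ResGLnCohomology.level 2 K D.𝔫) :
    D.vec X (pt K g (c * u)) = D.vec X (pt K g c) := by
  unfold vec
  congr 1
  refine Subtype.ext (funext fun l => funext fun m => ?_)
  rw [mapModel_apply, mapModel_apply, evalW_apply, evalW_apply]
  exact apply_pt_mul_of_fixed ((GL2CCuspForm.mem_levelFixed D.π).1 (D.ηX_mem_levelFixed X l m) _
    (Subgroup.mem_comap.1 hu)) g c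

/-- **Right `K_f(𝔫)`-invariance of the family.** [cite: BorelJacquet1979, §4.2] -/
theorem family_mul_level (c : BigHeckeGLn.FiniteAdelicGL 2 K) {u : BigHeckeGLn.FiniteAdelicGL 2 K}
    (hu : u ∈ ResGLnCohomology.level 2 K D.𝔫) : D.family (c * u) = D.family c :=
  LinearMap.ext fun X => funext fun M => by rw [family_apply, family_apply, D.vec_mul_level X _ c hu]

/-- `η(X)` read at `pt (σ₀γ · g) (γ c)` and at `pt g c` agree (automorphy). [cite: BorelJacquet1979, §4.2] -/
theorem vec_rat_mul (h2 : Module.finrank ℚ K = 2) (X : Mat) (γ : GL (Fin 2) K) (g : GL (Fin 2) ℂ)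
    (c : BigHeckeGLn.FiniteAdelicGL 2 K) :
    D.vec X (pt K (ratToComplexGL K 2 γ * g) (BigHeckeGLn.globalEmbedding 2 K γ * c)) = D.vec X (pt K g c) := by
  unfold vec
  congr 1
  refine Subtype.ext (funext fun l => funext fun m => ?_)
  rw [mapModel_apply, mapModel_apply, evalW_apply, evalW_apply]
  exact apply_pt_rat_mul h2 D.π ((D.ηX X : ℕ → ℕ → D.π.W) l m).2 γ g c

/-- `toGL (g M) = g · toGL M` for `M` invertible. [folklore] -/
theorem toGL_coe_mul {M : Mat} (hM : M ∈ GL2C.Inv) (g : GL (Fin 2) ℂ) : toGL ((g : Mat) * M) = g * toGL M := by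
  rw [show (g : Mat) * M = ((g * toGL M : GL (Fin 2) ℂ) : Mat) by rw [Units.val_mul, coe_toGL hM], toGL_coe]

/-- **Left `GL₂(K)`-equivariance of the family**: `family (γ c) X (σ₀γ · M) = E_λ(γ) (family c X M)`.
[cite: Harder1987, §3.1] -/
theorem family_rat_mul (h2 : Module.finrank ℚ K = 2) (γ : ResGLnCohomology.glTotPos 2 K) (c : BigHeckeGLn.FiniteAdelicGL 2 K)
    (X : Mat) {M : Mat} (hM : M ∈ GL2C.Inv) :
    D.family (ResGLnCohomology.diagPos 2 K γ * c) X
        ((((ratToComplexGL K 2).comp (ResGLnCohomology.glTotPos 2 K).subtype γ : GL (Fin 2) ℂ) : Mat) * M) =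
      ResGLnCohomology.coeffRepPos ℂ 2 K D.lam γ (D.family c X M) := by
  have hK : Subsingleton (InfinitePlace K) := subsingleton_infinitePlace K h2
  rw [family_apply, family_apply, toGL_coe_mul hM, MonoidHom.comp_apply, Subgroup.coe_subtype, MonoidHom.comp_apply,
    Subgroup.coe_subtype, D.vec_rat_mul h2, map_mul, coeffRepC_ratToComplexGL_pos K D.lam hK γ, Module.End.mul_apply]

/-- **The Eichler–Shimura–Harder family is an automorphic family of closed equivariant cochains**
for `Γ = GL₂(K)⁺ = GL₂(K)`, level `K_f(𝔫)`, coefficients `E_λ(ℂ)` and `a = σ₀`.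
[cite: Harder1987, §3.1] [cite: BorelWallach2000, VII §2.2] -/
theorem isAutomorphicFamily (h2 : Module.finrank ℚ K = 2) :
    GL2C.IsAutomorphicFamily (ResGLnCohomology.diagPos 2 K) (ResGLnCohomology.level 2 K D.𝔫)
      (ResGLnCohomology.coeffRepPos ℂ 2 K D.lam) ((ratToComplexGL K 2).comp (ResGLnCohomology.glTotPos 2 K).subtype)
      D.family where
  isCochain c := D.isCochain_family h2 c
  right_inv c _ hu := D.family_mul_level c hu
  equivariant γ c X _ _ hM := D.family_rat_mul h2 γ c X hM

end FamilyData

end GL2CESH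

end Literature.NumberTheory.Automorphic

end
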